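import Mathlib
import Literature.Computability.QuantumComplexity.SimonQueryBound
import HarnessLib

/-!
# Restricted-Hamming-weight Simon's problem: the deterministic classical query lower bound

Topic `Literature/Computability/QuantumComplexity`, companion of `SimonQueryBound.lean` /
`SimonLowerBound.lean` (the randomized `Ω(2^{n/2})` bound for the decision version).  Source:
P. Singkanipa, V. Kasatkin, Z. Zhou, G. Quiroz, D. A. Lidar, *Demonstration of algorithmic quantum
speedup for an Abelian hidden subgroup problem*, Phys. Rev. X **15**, 021082 (2025) =
arXiv:2401.07934 [SingkanipaEtAl2025] (held text `paper:arxiv-2401.07934`), §II.A (p. 2: “In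
wwSimon-n, the conditions are as follows: (i) HW(b) ≤ w; (ii) f(x) = f(y) if and only if x = y or
x = y ⊕ b; and (iii) b ≠ 0ⁿ”), §III.A eq. (2) (“Let S be the set of all possible values for the
hidden bitstring b ≠ 0ⁿ … restricted by HW(b) = w < n. The size of this set is
N_w ≡ Σ_{j=1}^{w} C(n, j)”), **Theorem 1** eq. (3) (“A lower bound on the worst-case number of
queries needed by a classical player to solve wwSimon-n is k ≥ ⌈√(2N_w − 7/4) + 1/2⌉ ≡ k_min(N_w)”;
“since this result is for a deterministic classical algorithm, it is also a lower bound on the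
worst-case classical NTS”) and its proof, Appendix C (p. 14: “Having made m queries, the player
forms the set R_m = {x_j ⊕ x_l : 1 ≤ j < l ≤ m}. If b ∈ R_m, then b = x_j ⊕ x_l for some j, l ≤ m
and y_j = y_l … if b ∉ R_m, then the only information learned after m queries is that b is not
in R_m … The player is guaranteed to know the correct b iff S ∖ S_k contains at most one element,
i.e., |S_k| ≥ N_w − 1, but |S_k| ≤ |R_k| ≤ k(k − 1)/2. Hence, k(k − 1)/2 ≥ N_w − 1. (C4)
Solving Eq. (C4) for k, we obtain Eq. (3).”).  The adversary step (“the player cannot benefit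
from adjusting the sequence of queried bitstrings based on the learned information”) is made
explicit here as `DTree.run_eq_of_agree` + `hasXorMask_prefRep`: every mask outside `R_k` admits
an instance agreeing with the collision-free transcript, so an adaptive deterministic algorithm
answers identically on all of them (de Wolf's “if the sequence is bad, then each sequence of T
distinct outcomes is equally likely — just as in the s = 0ⁿ case” [deWolf2019, §3.3.2]).

HONEST FRAMING (pub-qadeq lane context, CLAIMS rows E-30 (PRX 15, 021082) and E-41
(arXiv:2604.27457): “we observe exponential speedup over the classical lower-bound benchmark”, the
benchmark being this Theorem 1 — a QUERY lower bound in the black-box model; the rows' status is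
‘CERTIFIED-in-the-oracle-model’, with the primary's own caveat that the compiled oracle is a
Clifford circuit readable in linear time): instance-level adjudication of specific advantage
claims; no claim about BQP vs BPP or the summit.  This file proves the classical comparator the
rows are scored against, in the tree's query model (`SimonLB.DTree`); it says nothing about any
device or about runtime; the AVERAGE-case bound eqs. (4)–(5) / App. C (C5) is formalised in the
closing section `AverageCase` for the non-adaptive player of App. C (v2, harvest-2 gen 24): `Known`,
`queriesNeeded`, `card_sub_choose_two_le_card_filter_not_known` (the (C5) summand),
`sum_range_card_sub_choose_le_sum_queriesNeeded` ((C5)), `sum_range_sub_choose_two` (hockey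
stick), `sub_le_avg_queriesNeeded` (eq. (4)), `ntsLowerBound_le_avg_queriesNeeded` (eq. (5));
and for every ADAPTIVE player against the adversary's compilation in the final section
`Adaptive` (v3, harvest-2 gen 24): `DTree.queries_take_eq_of_agree`, `KnowsOn`,
`knowsOn_of_bad`, `queriesNeededOn`, `goodPrefix`, `advInstance` (`hasXorMask_advInstance`),
`queries_advInstance_take`, `queriesNeeded_le_queriesNeededOn` (“the player cannot benefit from
adjusting the sequence”), `sub_le_avg_queriesNeededOn` (eq. (4)),
`ntsLowerBound_le_avg_queriesNeededOn` (eq. (5)); and, in the closing section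
`RandomCompilation` (v4, harvest-2 gen 24), App. C AS PRINTED — `f` uniformly random among the
instances (the tree's model `twoToOne s g`, `g` a uniformly random permutation, of
`SimonQueryBound.lean`) AND an adaptive player: `DTree.truncate` / `queries_truncate`,
`not_knowsOn_twoToOne` (a competing consistent instance), `card_filter_not_bad_twoToOne_eq`
(`SimonQueryBound.bad_eq`: same collision statistics in the two-to-one and injective worlds),
`sum_card_filter_bad_le`, `card_perm_mul_sum_le_sum_queriesNeededOn` ((C5), count form),
`sub_le_avg_queriesNeededOn_twoToOne` (eq. (4)), `ntsLowerBound_le_avg_queriesNeededOn_twoToOne`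
(eq. (5)).

## Contents (all proved, 0 named facts; vocabulary reused from `SimonQueryBound.lean`:
`Bits n`, `bxor`, `rep`, `Bad`, `DTree.run/queries`, and `HasXorMask` from `QueryComplexity.lean`)

* `DTree.run_eq_of_agree` — an adaptive deterministic algorithm cannot distinguish two oracles
  that agree on the points it queries under one of them (same answers AND same query sequence).
* `hw b` (Hamming weight), `admissible n w = {b ≠ 0ⁿ : HW(b) ≤ w}` and **`card_admissible`**:
  `N_w = Σ_{j=1}^{w} C(n,j)` (eq. (2)), via `card_filter_hw_eq : #{b : HW(b) = j} = C(n,j)`.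
* `prefRep Q s` — the representative of the pair `{x, x ⊕ s}` preferring queried points — and
  `hasXorMask_prefRep`: when no two points of `Q` differ by `s`, `prefRep Q s` is a wwSimon
  instance with mask `s` (condition (ii)) that answers every query in `Q` by ITSELF, i.e. agrees
  with the injective oracle `id` on `Q` (the decomposition `f = f₁ ∘ f₀` of §II.C with `f₁ = id`).
* `card_filter_bad_ne_zero_le` — `|S ∩ R_k| ≤ |R_k| ≤ C(k', 2)`, `k'` = number of DISTINCT
  queried points (sharper than `SimonQueryBound.card_filter_bad_le`'s `k²`, as printed in (C4)).
* **`card_le_choose_two_add_one`** (Theorem 1 in the form (C4)): if a deterministic query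
  algorithm asking at most `k` queries on every oracle outputs the mask `b` on EVERY instance
  satisfying (ii) with `b ∈ S` (`0ⁿ ∉ S`), then `|S| ≤ C(k,2) + 1`; specialisations
  `admissible_card_le` (`N_w − 1 ≤ k(k−1)/2`, (C4)) and `two_pow_sub_one_le` (all nonzero masks:
  `2ⁿ − 1 ≤ k(k−1)/2 + 1`, (C3)).
* `kmin_le` — eq. (3) as printed: (C4) with `N_w ≥ 2` gives `√(2N_w − 7/4) + 1/2 ≤ k`.
-/

noncomputable section

namespace Literature.Computability.QuantumComplexity

namespace SimonLB

namespace DTree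

variable {Q A R : Type}

/-- **Adaptivity does not help against agreeing oracles.**  If `f'` gives the same answers as `f`
on every point the tree queries when run on `f`, then the run on `f'` asks the same queries and
returns the same result. (App. C: “the player cannot benefit from adjusting the sequence of
queried bitstrings based on the learned information and can assume that the classical algorithm is
fully described by the sequence x₁, x₂, …, x_k”.) [cite: SingkanipaEtAl2025, App. C] -/
theorem run_eq_of_agree {f f' : Q → A} :
    ∀ t : DTree Q A R, (∀ q ∈ t.queries f, f' q = f q) →
      t.run f' = t.run f ∧ t.queries f' = t.queries f
  | leaf r, _ => ⟨rfl, rfl⟩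
  | node q next, h => by
      have hq : f' q = f q := h q (by simp)
      have ih := run_eq_of_agree (next (f q)) fun q' hq' => h q' (by simp [hq'])
      simp only [run_node, queries_node, hq]
      exact ⟨ih.1, by rw [ih.2]⟩

end DTree

open Finset

variable {n : ℕ}

/-! ## Hamming weight and the admissible masks `S`, `N_w = Σ_{j=1}^{w} C(n,j)` -/

/-- The Hamming weight `HW(b)` of a bit string: the number of ones. [cite: SingkanipaEtAl2025, §II.A (i)] -/
def hw (b : Bits n) : ℕ := (univ.filter fun i => b i = true).card

/-- `HW(b) = 0 ↔ b = 0ⁿ`. [cite: SingkanipaEtAl2025, §II.A (iii)] -/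
theorem hw_eq_zero_iff (b : Bits n) : hw b = 0 ↔ b = fun _ => false := by
  unfold hw
  rw [card_eq_zero, filter_eq_empty_iff]
  constructor
  · intro h; funext i; simpa using h (mem_univ i)
  · rintro rfl i _; simp

/-- The support map `b ↦ {i : bᵢ = 1}` is injective (a bit string is its set of ones). [folklore] -/
private theorem support_injective :
    Function.Injective fun b : Bits n => univ.filter fun i => b i = true := by
  intro b b' h
  funext i
  have := congrArg (fun s : Finset (Fin n) => decide (i ∈ s)) h
  simp only [mem_filter, mem_univ, true_and, Bool.decide_eq_true] at this
  exact this

/-- The bit strings of Hamming weight `j` are in bijection with the `j`-subsets of the `n`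
positions: `#{b : HW(b) = j} = C(n, j)`. [cite: SingkanipaEtAl2025, §III.A eq. (2)] -/
theorem card_filter_hw_eq (n j : ℕ) :
    (univ.filter fun b : Bits n => hw b = j).card = n.choose j := by
  rw [← card_image_of_injective _ (support_injective (n := n))]
  have : (univ.filter fun b : Bits n => hw b = j).image
      (fun b : Bits n => univ.filter fun i => b i = true) = powersetCard j univ := by
    ext s
    simp only [mem_image, mem_filter, mem_univ, true_and, mem_powersetCard, subset_univ]
    constructor
    · rintro ⟨b, hb, rfl⟩; exact hb
    · intro hs
      refine ⟨fun i => decide (i ∈ s), ?_, ?_⟩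
      · unfold hw
        convert hs using 2
        ext i; simp
      · ext i; simp
  rw [this, card_powersetCard, card_univ, Fintype.card_fin]

/-- The admissible hidden strings of wwSimon-n: `S = {b ≠ 0ⁿ : HW(b) ≤ w}`.
[cite: SingkanipaEtAl2025, §III.A (“the set S of possible values of b is restricted by HW(b)”)] -/
def admissible (n w : ℕ) : Finset (Bits n) :=
  univ.filter fun b => b ≠ (fun _ => false) ∧ hw b ≤ w

/-- `0ⁿ ∉ S` (condition (iii)). [cite: SingkanipaEtAl2025, §II.A (iii)] -/
theorem zero_notMem_admissible (n w : ℕ) : (fun _ => false : Bits n) ∉ admissible n w := by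
  simp [admissible]

/-- **Eq. (2)**: `N_w = |S| = Σ_{j=1}^{w} C(n, j)`. [cite: SingkanipaEtAl2025, §III.A eq. (2)] -/
theorem card_admissible (n w : ℕ) :
    (admissible n w).card = ∑ j ∈ Icc 1 w, n.choose j := by
  have hmem : ∀ b ∈ admissible n w, hw b ∈ Icc 1 w := by
    intro b hb
    simp only [admissible, mem_filter, mem_univ, true_and] at hb
    rw [mem_Icc]
    refine ⟨Nat.one_le_iff_ne_zero.mpr ?_, hb.2⟩
    rw [Ne, hw_eq_zero_iff]; exact hb.1
  rw [card_eq_sum_card_fiberwise hmem]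
  refine sum_congr rfl fun j hj => ?_
  rw [mem_Icc] at hj
  rw [← card_filter_hw_eq n j]
  congr 1
  ext b
  simp only [admissible, mem_filter, mem_univ, true_and]
  constructor
  · rintro ⟨_, h⟩; exact h
  · intro h
    refine ⟨⟨?_, h ▸ hj.2⟩, h⟩
    intro hb
    rw [← hw_eq_zero_iff] at hb
    omega

/-! ## The adversary's instances: a representative map preferring queried points -/

/-- The representative of the pair `{x, x ⊕ s}` that prefers points of `Q` (and otherwise the
lexicographically smaller one, `rep s`): the two-to-one instance the adversary keeps consistent
with a collision-free transcript on `Q` (“f(x) = f₁(f₀(x)) where f₀ is any 2-to-1 function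
satisfying condition (ii) with the same b”, §II.C). [cite: SingkanipaEtAl2025, §II.C and App. C] -/
def prefRep (Q : Finset (Bits n)) (s x : Bits n) : Bits n :=
  if x ∈ Q then x else if bxor x s ∈ Q then bxor x s else rep s x

/-- The representative is one of `x`, `x ⊕ s`. [folklore] -/
private theorem prefRep_eq_or (Q : Finset (Bits n)) (s x : Bits n) :
    prefRep Q s x = x ∨ prefRep Q s x = bxor x s := by
  unfold prefRep
  split_ifs
  · exact Or.inl rfl
  · exact Or.inr rfl
  · exact rep_eq_or s x

/-- Queried points represent themselves. [folklore] -/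
private theorem prefRep_of_mem {Q : Finset (Bits n)} (s : Bits n) {x : Bits n} (hx : x ∈ Q) :
    prefRep Q s x = x := by
  unfold prefRep; rw [if_pos hx]

/-- If no two points of `Q` differ by `s` (`s ∉ R_k`), then `x` and `x ⊕ s` have the same
representative. [cite: SingkanipaEtAl2025, App. C (b ∉ R_m)] -/
private theorem prefRep_bxor {Q : Finset (Bits n)} {s : Bits n} (hQ : ∀ a ∈ Q, bxor a s ∉ Q)
    (x : Bits n) : prefRep Q s (bxor x s) = prefRep Q s x := by
  unfold prefRep
  rw [bxor_bxor_cancel]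
  by_cases hx : x ∈ Q
  · have hxs : bxor x s ∉ Q := hQ x hx
    rw [if_neg hxs, if_pos hx, if_pos hx]
  · by_cases hxs : bxor x s ∈ Q
    · rw [if_pos hxs, if_neg hx, if_pos hxs]
    · rw [if_neg hxs, if_neg hx, if_neg hx, if_neg hxs, rep_bxor]

/-- **The adversary's instance.**  If no two points of `Q` differ by `s`, then `prefRep Q s`
satisfies Simon's condition (ii) with mask `s` — `f(x) = f(y) ↔ x = y ∨ x = y ⊕ s` — while
answering every query `x ∈ Q` by `x` itself, exactly as the injective oracle `id` does.
[cite: SingkanipaEtAl2025, §II.A (ii) and App. C] -/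
theorem hasXorMask_prefRep {Q : Finset (Bits n)} {s : Bits n} (hQ : ∀ a ∈ Q, bxor a s ∉ Q) :
    HasXorMask (prefRep Q s) s ∧ ∀ x ∈ Q, prefRep Q s x = x := by
  refine ⟨fun x y => ?_, fun x hx => prefRep_of_mem s hx⟩
  constructor
  · intro h
    rcases prefRep_eq_or Q s x with hx | hx <;> rcases prefRep_eq_or Q s y with hy | hy <;>
      rw [hx, hy] at h
    · exact Or.inl h.symm
    · right; rw [← bxor_bxor_cancel y s, ← h]; rfl
    · right; rw [← h]; rfl
    · left; have := congrArg (fun t => bxor t s) h; simpa using this.symm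
  · rintro (rfl | rfl)
    · rfl
    · exact (prefRep_bxor hQ x).symm

/-! ## Counting the excluded masks: `|R_k| ≤ k(k−1)/2` -/

/-- **`|S_k| ≤ |R_k| ≤ k(k−1)/2`.**  The nonzero masks for which a list of queried points shows a
collision are among the xors `x_j ⊕ x_l` of UNORDERED pairs of distinct queried points, hence at
most `C(k', 2)` of them, `k'` the number of distinct points queried.
[cite: SingkanipaEtAl2025, App. C (“|S_k| ≤ |R_k| ≤ k(k − 1)/2”)] -/
theorem card_filter_bad_ne_zero_le (L : List (Bits n))
    [DecidablePred fun s : Bits n => s ≠ (fun _ => false) ∧ Bad s L] :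
    (univ.filter fun s : Bits n => s ≠ (fun _ => false) ∧ Bad s L).card ≤
      L.toFinset.card.choose 2 := by
  classical
  let xorSym : Sym2 (Bits n) → Bits n :=
    Sym2.lift ⟨fun a b => bxor a b, fun a b => bxor_comm a b⟩
  calc (univ.filter fun s : Bits n => s ≠ (fun _ => false) ∧ Bad s L).card
      ≤ ((L.toFinset.offDiag.image (Function.uncurry Sym2.mk)).image xorSym).card := by
        refine card_le_card fun s hs => ?_
        simp only [mem_filter, mem_univ, true_and] at hs
        obtain ⟨hs0, a, ha, b, hb, hab⟩ := hs
        have hne : a ≠ b := by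
          rintro rfl
          exact hs0 ((bxor_eq_self_iff a s).1 hab)
        refine mem_image.2 ⟨s(a, b), mem_image.2 ⟨(a, b), ?_, rfl⟩, ?_⟩
        · exact mem_offDiag.2 ⟨List.mem_toFinset.2 ha, List.mem_toFinset.2 hb, hne⟩
        · change bxor a b = s
          exact ((bxor_eq_iff a s b).1 hab).symm
    _ ≤ (L.toFinset.offDiag.image (Function.uncurry Sym2.mk)).card := card_image_le
    _ = L.toFinset.card.choose 2 := Sym2.card_image_offDiag _

/-! ## Theorem 1: `k(k−1)/2 ≥ N_w − 1` -/

/-- **Theorem 1 (form (C4)): a deterministic classical player that always knows `b` after `k`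
queries has `|S| ≤ k(k−1)/2 + 1`.**  Let `t` be any adaptive deterministic query algorithm
(queries `x ∈ {0,1}ⁿ`, answers `f(x) ∈ {0,1}ⁿ`, output a bit string) asking at most `k` queries
on every oracle, and `S` a set of nonzero candidate masks.  If `t` outputs `b` on EVERY function
satisfying condition (ii) with any `b ∈ S`, then `|S| ≤ C(k, 2) + 1`: run `t` against the
injective oracle; the masks outside the `≤ C(k,2)` pairwise xors of the queried points all admit
instances with the same transcript (`hasXorMask_prefRep`, `DTree.run_eq_of_agree`), so `t` gives
ONE answer for all of them and at most one such mask can exist (“S ∖ S_k should contain at most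
one element … but |S_k| ≤ |R_k| ≤ k(k − 1)/2”). [cite: SingkanipaEtAl2025, Theorem 1 and App. C eq. (C4)] -/
theorem card_le_choose_two_add_one {k : ℕ} (t : DTree (Bits n) (Bits n) (Bits n))
    (hk : ∀ f : Bits n → Bits n, (t.queries f).length ≤ k) (S : Finset (Bits n))
    (h0 : (fun _ => false : Bits n) ∉ S)
    (hsolve : ∀ s ∈ S, ∀ f : Bits n → Bits n, HasXorMask f s → t.run f = s) :
    S.card ≤ k.choose 2 + 1 := by
  classical
  -- the transcript against the injective oracle `id`
  set L : List (Bits n) := t.queries id with hL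
  -- masks showing no collision on `L` are all answered by `t.run id`
  have hconst : ∀ s ∈ S, ¬ Bad s L → s = t.run id := by
    intro s hs hbad
    have hQ : ∀ a ∈ L.toFinset, bxor a s ∉ L.toFinset := by
      intro a ha hmem
      exact hbad ⟨a, List.mem_toFinset.1 ha, bxor a s, List.mem_toFinset.1 hmem, rfl⟩
    obtain ⟨hmask, hagree⟩ := hasXorMask_prefRep hQ
    have hrun := (DTree.run_eq_of_agree (f := id) (f' := prefRep L.toFinset s) t
      fun q hq => hagree q (List.mem_toFinset.2 hq)).1
    rw [← hsolve s hs _ hmask, hrun]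
  -- hence at most one of them
  have h1 : (S.filter fun s => ¬ Bad s L).card ≤ 1 := by
    refine card_le_one.2 fun a ha b hb => ?_
    rw [mem_filter] at ha hb
    rw [hconst a ha.1 ha.2, hconst b hb.1 hb.2]
  -- and the others are among the ≤ C(k,2) pairwise xors
  have h2 : (S.filter fun s => Bad s L).card ≤ k.choose 2 := by
    calc (S.filter fun s => Bad s L).card
        ≤ (univ.filter fun s : Bits n => s ≠ (fun _ => false) ∧ Bad s L).card := by
          refine card_le_card fun s hs => ?_
          rw [mem_filter] at hs
          exact mem_filter.2 ⟨mem_univ _, fun h => h0 (h ▸ hs.1), hs.2⟩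
      _ ≤ L.toFinset.card.choose 2 := card_filter_bad_ne_zero_le L
      _ ≤ k.choose 2 := Nat.choose_le_choose 2 ((List.toFinset_card_le L).trans (hk id))
  rw [← card_filter_add_card_filter_not (fun s => Bad s L)]
  omega

/-- **Theorem 1 for wwSimon-n, eq. (C4)**: `N_w − 1 ≤ k(k−1)/2` for every deterministic classical
player that solves every admissible instance with at most `k` queries. [cite: SingkanipaEtAl2025, Theorem 1, App. C eq. (C4)] -/
theorem admissible_card_le {k w : ℕ} (t : DTree (Bits n) (Bits n) (Bits n))
    (hk : ∀ f : Bits n → Bits n, (t.queries f).length ≤ k)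
    (hsolve : ∀ s ∈ admissible n w, ∀ f : Bits n → Bits n, HasXorMask f s → t.run f = s) :
    ∑ j ∈ Icc 1 w, n.choose j ≤ k.choose 2 + 1 := by
  rw [← card_admissible]
  exact card_le_choose_two_add_one t hk _ (zero_notMem_admissible n w) hsolve

/-- **The unrestricted case, eq. (C3)**: with all `N_n = 2ⁿ − 1` nonzero masks admissible,
`2ⁿ − 1 ≤ k(k−1)/2 + 1`. [cite: SingkanipaEtAl2025, App. C eq. (C3)] -/
theorem two_pow_sub_one_le {k : ℕ} (t : DTree (Bits n) (Bits n) (Bits n))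
    (hk : ∀ f : Bits n → Bits n, (t.queries f).length ≤ k)
    (hsolve : ∀ s : Bits n, s ≠ (fun _ => false) →
      ∀ f : Bits n → Bits n, HasXorMask f s → t.run f = s) :
    2 ^ n - 1 ≤ k.choose 2 + 1 := by
  classical
  have hS : (univ.filter fun s : Bits n => s ≠ fun _ => false).card = 2 ^ n - 1 := by
    rw [filter_ne' univ, card_erase_of_mem (mem_univ _), card_univ, Fintype.card_fun,
      Fintype.card_bool, Fintype.card_fin]
  rw [← hS]
  refine card_le_choose_two_add_one t hk _ (by simp) fun s hs => hsolve s ?_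
  simpa using hs

/-! ## Eq. (3): the closed form `k ≥ √(2N_w − 7/4) + 1/2` -/

/-- **Eq. (3) from (C4)**: for `N ≥ 2`, `N − 1 ≤ k(k−1)/2` forces `k ≥ √(2N − 7/4) + 1/2`
(so `k ≥ k_min(N) = ⌈√(2N − 7/4) + 1/2⌉`; “for constant w, N_w ∼ n^w, k_min ∼ n^{w/2}”).
[cite: SingkanipaEtAl2025, Theorem 1 eq. (3)] -/
theorem kmin_le {N k : ℕ} (hN : 2 ≤ N) (h : N - 1 ≤ k.choose 2) :
    Real.sqrt (2 * N - 7 / 4) + 1 / 2 ≤ k := by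
  have hk2 : 2 ≤ k := by
    by_contra hk
    interval_cases k <;> simp at h <;> omega
  rw [Nat.choose_two_right] at h
  have h' : ((N : ℝ) - 1) ≤ (k : ℝ) * (k - 1) / 2 := by
    have h1 : ((N - 1 : ℕ) : ℝ) ≤ ((k * (k - 1) / 2 : ℕ) : ℝ) := by exact_mod_cast h
    have h2 : ((k * (k - 1) / 2 : ℕ) : ℝ) ≤ (k : ℝ) * (k - 1) / 2 := by
      have := Nat.cast_div_le (m := k * (k - 1)) (n := 2) (α := ℝ)
      push_cast [Nat.cast_sub (by omega : 1 ≤ k)] at this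
      exact this
    have h3 : ((N - 1 : ℕ) : ℝ) = (N : ℝ) - 1 := by push_cast [Nat.cast_sub (by omega : 1 ≤ N)]; ring
    linarith
  have hsq : (2 * (N : ℝ) - 7 / 4) ≤ ((k : ℝ) - 1 / 2) ^ 2 := by nlinarith
  have hk' : (0 : ℝ) ≤ (k : ℝ) - 1 / 2 := by
    have : (2 : ℝ) ≤ k := by exact_mod_cast hk2
    linarith
  calc Real.sqrt (2 * N - 7 / 4) + 1 / 2 ≤ Real.sqrt (((k : ℝ) - 1 / 2) ^ 2) + 1 / 2 := by
        gcongr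
    _ = k := by rw [Real.sqrt_sq hk']; ring

/-! ## Eqs. (4)–(5): the AVERAGE number of classical queries (App. C, display (C5))

The paper's average-case statement is made for the NON-ADAPTIVE player of App. C (“the player
cannot benefit from adjusting the sequence of queried bitstrings based on the learned information
and can assume that the classical algorithm is fully described by the sequence x₁, x₂, …, x_k”):
for a fixed query sequence and a mask `b ∈ S`, query number `i + 1` is NEEDED iff after `i`
queries `b` is not yet known — neither revealed by a collision (`b ∈ S_i = S ∩ R_i`) nor the
unique candidate left (“S ∖ S_k contains at most one element”).  “The lower bound Eq. (4) can now
be obtained by summing the lower bounds on the probability b ∉ S_i.  Since there are at most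
i(i−1)/2 elements in S_i, and the total number of possible b values is N_w, we have
Pr(b ∈ S_i) ≤ i(i−1)/(2N_w).  The probability that the next query #i+1 is needed (i.e., that i
queries are not enough: i = 0, …, k−1) is 1 − Pr(b ∈ S_i), yielding
⟨Q_C⟩ ≥ Σ_{i=0}^{k−1} (1 − i(i−1)/(2N_w)) (C5), and after evaluating the sum we obtain Eq. (4)”
[`⟨Q_C⟩ ≥ k − k(k−1)(k−2)/(6N_w)` (4); with `k = k_min`:
`NTS_C ≥ NTS^lb_C(N_w) ≡ k_min − k_min(k_min−1)(k_min−2)/(6N_w)` (5), “the lower bound on the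
average case classical NTS” — the benchmark curve rows E-30 / E-41 are scored against].
Probabilities are over the uniform prior on `b ∈ S` (“their posterior distribution of all
possible values of b is uniform in S ∖ S_k”); here every ‘probability’ is the corresponding COUNT
of masks in `S`, and the expectation is the sum over `b ∈ S` divided by `|S|`. -/

section AverageCase

open scoped Classical

/-- After `i` queries of the non-adaptive sequence `xs` the player KNOWS the mask `b`: a collision
among the first `i` queried points reveals it (`b ∈ R_i`), or `b` is the only mask of `S` the
collision-free transcript has not excluded (“S ∖ S_k contains at most one element”).
[cite: SingkanipaEtAl2025, App. C (proof of Theorem 1: R_m, S_k, “the player is guaranteed to know the correct b iff S ∖ S_k contains at most one element”)] -/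
def Known (S : Finset (Bits n)) (xs : List (Bits n)) (i : ℕ) (b : Bits n) : Prop :=
  Bad b (xs.take i) ∨ ∀ b' ∈ S, ¬ Bad b' (xs.take i) → b' = b

/-- Knowledge is monotone in the number of queries. [cite: SingkanipaEtAl2025, App. C (R_m ⊆ R_{m+1})] -/
theorem Known.mono {S : Finset (Bits n)} {xs : List (Bits n)} {i j : ℕ} (hij : i ≤ j) {b : Bits n}
    (h : Known S xs i b) : Known S xs j b := by
  have hsub : xs.take i ⊆ xs.take j := fun x hx =>
    (List.take_subset_take_left (l := xs) hij) hx
  rcases h with h | h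
  · exact Or.inl (h.mono hsub)
  · exact Or.inr fun b' hb' hnb => h b' hb' fun hbad => hnb (hbad.mono hsub)

/-- The number of classical queries the player spends on the mask `b`: the number of rounds
`i < |xs|` at which “the next query #i+1 is needed (i.e., i queries are not enough)”.
[cite: SingkanipaEtAl2025, App. C (display (C5): “the probability that the next query #i+1 is needed”)] -/
def queriesNeeded (S : Finset (Bits n)) (xs : List (Bits n)) (b : Bits n) : ℕ :=
  ((range xs.length).filter fun i => ¬ Known S xs i b).card

/-- The player never spends more queries than the sequence has. [cite: SingkanipaEtAl2025, App. C] -/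
theorem queriesNeeded_le_length (S : Finset (Bits n)) (xs : List (Bits n)) (b : Bits n) :
    queriesNeeded S xs b ≤ xs.length := by
  unfold queriesNeeded
  exact (card_filter_le _ _).trans (by simp)

/-- **`|S_i| ≤ i(i−1)/2`, counted inside `S`**: the masks of `S` (a set of nonzero masks) revealed
by a collision among the first `i` queried points number at most `C(i, 2)`.
[cite: SingkanipaEtAl2025, App. C (“Since there are at most i(i−1)/2 elements in S_i”)] -/
theorem card_filter_bad_take_le (S : Finset (Bits n)) (h0 : (fun _ => false : Bits n) ∉ S)
    (xs : List (Bits n)) (i : ℕ) :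
    (S.filter fun b => Bad b (xs.take i)).card ≤ i.choose 2 := by
  calc (S.filter fun b => Bad b (xs.take i)).card
      ≤ (univ.filter fun s : Bits n => s ≠ (fun _ => false) ∧ Bad s (xs.take i)).card := by
        refine card_le_card fun s hs => ?_
        rw [mem_filter] at hs
        exact mem_filter.2 ⟨mem_univ _, fun h => h0 (h ▸ hs.1), hs.2⟩
    _ ≤ (xs.take i).toFinset.card.choose 2 := card_filter_bad_ne_zero_le _
    _ ≤ i.choose 2 := Nat.choose_le_choose 2
        ((List.toFinset_card_le _).trans (by rw [List.length_take]; exact min_le_left _ _))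

/-- **The summand of (C5)**: if `C(i,2) + 2 ≤ |S|`, then at least `|S| − C(i,2)` masks of `S`
still need query `i + 1` — every mask outside `S_i` does, because at least two candidates remain
(“Pr(b ∈ S_i) ≤ i(i−1)/(2N_w) … the probability that the next query #i+1 is needed … is
1 − Pr(b ∈ S_i)”). [cite: SingkanipaEtAl2025, App. C display (C5) (the summand)] -/
theorem card_sub_choose_two_le_card_filter_not_known (S : Finset (Bits n))
    (h0 : (fun _ => false : Bits n) ∉ S) (xs : List (Bits n)) {i : ℕ}
    (hi : i.choose 2 + 2 ≤ S.card) :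
    S.card - i.choose 2 ≤ (S.filter fun b => ¬ Known S xs i b).card := by
  have hB := card_filter_bad_take_le S h0 xs i
  -- the collision-free candidates: at least two of them
  have hsplit := card_filter_add_card_filter_not (s := S) (fun b => Bad b (xs.take i))
  have hNB : 2 ≤ (S.filter fun b => ¬ Bad b (xs.take i)).card := by omega
  -- each of them is not yet known
  have hsub : (S.filter fun b => ¬ Bad b (xs.take i)) ⊆ (S.filter fun b => ¬ Known S xs i b) := by
    intro b hb
    rw [mem_filter] at hb ⊢
    refine ⟨hb.1, ?_⟩
    rintro (hbad | huniq)
    · exact hb.2 hbad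
    · -- uniqueness would leave at most one collision-free candidate
      have h1 : (S.filter fun b' => ¬ Bad b' (xs.take i)).card ≤ 1 := by
        refine card_le_one.2 fun a ha c hc => ?_
        rw [mem_filter] at ha hc
        rw [huniq a ha.1 ha.2, huniq c hc.1 hc.2]
      omega
  calc S.card - i.choose 2 ≤ (S.filter fun b => ¬ Bad b (xs.take i)).card := by omega
    _ ≤ (S.filter fun b => ¬ Known S xs i b).card := card_le_card hsub

/-- **Display (C5), summed over the prior**: for every non-adaptive query sequence `xs` and every
`k ≤ |xs|` with `C(k−1, 2) + 2 ≤ |S|` (i.e. `k ≤ k_min(|S|)`),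
`Σ_{b ∈ S} Q_C(b) ≥ Σ_{i=0}^{k−1} (|S| − C(i,2))` — the count form of
`⟨Q_C⟩ ≥ Σ_{i=0}^{k−1} (1 − i(i−1)/(2N_w))`. [cite: SingkanipaEtAl2025, App. C display (C5)] -/
theorem sum_range_card_sub_choose_le_sum_queriesNeeded (S : Finset (Bits n))
    (h0 : (fun _ => false : Bits n) ∉ S) (xs : List (Bits n)) {k : ℕ} (hk : k ≤ xs.length)
    (hS : (k - 1).choose 2 + 2 ≤ S.card) :
    ∑ i ∈ range k, (S.card - i.choose 2) ≤ ∑ b ∈ S, queriesNeeded S xs b := by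
  -- exchange the two sums: Σ_b Q_C(b) = Σ_{i < |xs|} #{b ∈ S : query i+1 needed}
  have hswap : ∑ b ∈ S, queriesNeeded S xs b =
      ∑ i ∈ range xs.length, (S.filter fun b => ¬ Known S xs i b).card := by
    unfold queriesNeeded
    simp_rw [card_filter]
    exact sum_comm
  rw [hswap]
  calc ∑ i ∈ range k, (S.card - i.choose 2)
      ≤ ∑ i ∈ range k, (S.filter fun b => ¬ Known S xs i b).card := by
        refine sum_le_sum fun i hi => card_sub_choose_two_le_card_filter_not_known S h0 xs ?_
        have hik : i ≤ k - 1 := by have := mem_range.1 hi; omega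
        exact (Nat.add_le_add_right (Nat.choose_le_choose 2 hik) 2).trans hS
    _ ≤ ∑ i ∈ range xs.length, (S.filter fun b => ¬ Known S xs i b).card :=
        sum_le_sum_of_subset_of_nonneg (range_subset_range.2 hk) fun _ _ _ => Nat.zero_le _

/-- **“After evaluating the sum”**: `Σ_{i<k} C(i,2) = C(k,3)` (hockey stick), so
`Σ_{i=0}^{k−1} (N − C(i,2)) = kN − C(k,3)` whenever every `C(i,2) ≤ N`.
[cite: SingkanipaEtAl2025, App. C (“after evaluating the sum we obtain Eq. (4)”)] -/
theorem sum_range_sub_choose_two {N k : ℕ} (h : ∀ i < k, i.choose 2 ≤ N) :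
    ∑ i ∈ range k, (N - i.choose 2) + k.choose 3 = k * N := by
  have hsum : ∑ i ∈ range k, i.choose 2 = k.choose 3 := by
    clear h
    induction k with
    | zero => simp
    | succ k ih => rw [sum_range_succ, ih, Nat.choose_succ_succ' k 2, add_comm]
  have hle : ∑ i ∈ range k, i.choose 2 ≤ ∑ i ∈ range k, N :=
    sum_le_sum fun i hi => h i (mem_range.1 hi)
  have hsplit : ∑ i ∈ range k, (N - i.choose 2) + ∑ i ∈ range k, i.choose 2 = ∑ i ∈ range k, N := by
    rw [← sum_add_distrib]
    exact sum_congr rfl fun i hi => Nat.sub_add_cancel (h i (mem_range.1 hi))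
  rw [← hsum]
  rw [sum_const, card_range, smul_eq_mul] at hsplit
  exact hsplit

/-- `6 · C(k,3) = k(k−1)(k−2)`. [folklore] -/
private theorem six_mul_choose_three (k : ℕ) : 6 * k.choose 3 = k * (k - 1) * (k - 2) := by
  have h := Nat.descFactorial_eq_factorial_mul_choose k 3
  rw [show Nat.factorial 3 = 6 by rfl] at h
  rw [← h]
  simp [Nat.descFactorial_succ]
  ring

/-- **Eq. (4)** (average over the uniform prior on `S`, for the non-adaptive player): for every
query sequence `xs` and every `k ≤ |xs|` with `C(k−1,2) + 2 ≤ |S|`,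
`(1/|S|) Σ_{b∈S} Q_C(b) ≥ k − k(k−1)(k−2)/(6|S|)`.
[cite: SingkanipaEtAl2025, §III.A eq. (4) and App. C (C5)] -/
theorem sub_le_avg_queriesNeeded (S : Finset (Bits n)) (h0 : (fun _ => false : Bits n) ∉ S)
    (xs : List (Bits n)) {k : ℕ} (hk : k ≤ xs.length) (hS : (k - 1).choose 2 + 2 ≤ S.card) :
    (k : ℚ) - (k : ℚ) * (k - 1) * (k - 2) / (6 * S.card) ≤
      (∑ b ∈ S, (queriesNeeded S xs b : ℚ)) / S.card := by
  have hSpos : 0 < S.card := by omega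
  have hle := sum_range_card_sub_choose_le_sum_queriesNeeded S h0 xs hk hS
  have hchoose : ∀ i < k, i.choose 2 ≤ S.card := fun i hi =>
    ((Nat.choose_le_choose 2 (show i ≤ k - 1 by omega)).trans (by omega))
  have hclosed := sum_range_sub_choose_two (N := S.card) hchoose
  -- cast to ℚ
  have hq : (k : ℚ) * S.card - k.choose 3 ≤ ∑ b ∈ S, (queriesNeeded S xs b : ℚ) := by
    have h1 : ((∑ i ∈ range k, (S.card - i.choose 2) : ℕ) : ℚ) ≤
        ((∑ b ∈ S, queriesNeeded S xs b : ℕ) : ℚ) := by exact_mod_cast hle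
    have h2 : ((∑ i ∈ range k, (S.card - i.choose 2) : ℕ) : ℚ) = (k : ℚ) * S.card - k.choose 3 := by
      have := congrArg (fun m : ℕ => (m : ℚ)) hclosed
      push_cast at this ⊢
      linarith
    rw [h2] at h1
    push_cast at h1
    exact h1
  have h6 : ((k.choose 3 : ℕ) : ℚ) = (k : ℚ) * (k - 1) * (k - 2) / 6 := by
    have h := congrArg (fun m : ℕ => (m : ℚ)) (six_mul_choose_three k)
    push_cast at h
    rcases Nat.lt_or_ge k 2 with hk2 | hk2
    · interval_cases k <;> simp
    · rw [Nat.cast_sub (by omega : 1 ≤ k), Nat.cast_sub hk2] at h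
      push_cast at h
      linarith
  rw [h6] at hq
  have hS' : (0 : ℚ) < S.card := by exact_mod_cast hSpos
  rw [le_div_iff₀ hS']
  have : ((k : ℚ) - (k : ℚ) * (k - 1) * (k - 2) / (6 * S.card)) * S.card =
      (k : ℚ) * S.card - (k : ℚ) * (k - 1) * (k - 2) / 6 := by
    field_simp
  rw [this]
  exact hq

/-- A sequence that lets the player know EVERY mask of `S` by its end is at least as long as
Theorem 1 demands: `|S| ≤ C(|xs|, 2) + 1` (the non-adaptive form of (C4)); in particular the
hypothesis `C(k−1,2) + 2 ≤ |S|` of eq. (4) holds for every `k ≤ k_min(|S|)` and `k_min ≤ |xs|`.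
[cite: SingkanipaEtAl2025, App. C eq. (C4)] -/
theorem card_le_choose_two_length_add_one (S : Finset (Bits n))
    (h0 : (fun _ => false : Bits n) ∉ S) (xs : List (Bits n))
    (hsolve : ∀ b ∈ S, Known S xs xs.length b) : S.card ≤ xs.length.choose 2 + 1 := by
  by_contra hlt
  have hi : xs.length.choose 2 + 2 ≤ S.card := by omega
  have h := card_sub_choose_two_le_card_filter_not_known S h0 xs hi
  have hzero : (S.filter fun b => ¬ Known S xs xs.length b).card = 0 :=
    card_eq_zero.2 (filter_eq_empty_iff.2 fun b hb hn => hn (hsolve b hb))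
  omega

/-- **Eq. (5) for wwSimon-n**: with `S` the admissible masks (`|S| = N_w = Σ_{j=1}^{w} C(n,j)`,
`card_admissible`), every non-adaptive classical player and every `k ≤ |xs|` with
`C(k−1,2) + 2 ≤ N_w` — in particular `k = k_min(N_w)` — satisfy
`NTS_C ≥ ⟨Q_C⟩ ≥ k − k(k−1)(k−2)/(6N_w)`, the ‘classical lower-bound benchmark’ `NTS^lb_C(N_w)`.
[cite: SingkanipaEtAl2025, §III.A eq. (5)] -/
theorem ntsLowerBound_le_avg_queriesNeeded {w : ℕ} (xs : List (Bits n)) {k : ℕ}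
    (hk : k ≤ xs.length) (hS : (k - 1).choose 2 + 2 ≤ ∑ j ∈ Icc 1 w, n.choose j) :
    (k : ℚ) - (k : ℚ) * (k - 1) * (k - 2) / (6 * (∑ j ∈ Icc 1 w, n.choose j : ℕ)) ≤
      (∑ b ∈ admissible n w, (queriesNeeded (admissible n w) xs b : ℚ)) /
        (∑ j ∈ Icc 1 w, n.choose j : ℕ) := by
  rw [← card_admissible] at hS ⊢
  exact sub_le_avg_queriesNeeded _ (zero_notMem_admissible n w) xs hk hS

end AverageCase

/-! ## App. C for ADAPTIVE players (v3): the adversary's compilation re-asks the `id`-run sequence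

“Thus, the player cannot benefit from adjusting the sequence of queried bitstrings based on the
learned information and can assume that the classical algorithm is fully described by the
sequence x₁, x₂, …, x_k” (App. C).  Made explicit here in the ADVERSARY-ORACLE form: for an
adaptive deterministic player `t` (a decision tree) let `xs = t.queries id` be its query sequence
against the injective oracle; for each mask `b` the instance `advInstance t b` — condition (ii)
with mask `b` — answers the collision-free prefix of `xs` by the queried points themselves, so on
it `t` re-asks `xs` up to and including its first `b`-collision, and at every earlier round some
other collision-free candidate `b' ∈ S` owns an instance with the very same transcript.  Hence
the number of rounds at which `t` does not yet know `b` on `advInstance t b` is at least the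
non-adaptive count `queriesNeeded S xs b` of section `AverageCase`, and eqs. (4)–(5) hold for
the adaptive player `t` on these instances, averaged over the uniform prior on `S`
(`sub_le_avg_queriesNeededOn`, `ntsLowerBound_le_avg_queriesNeededOn`).  NOT formalised: the
paper's reading with `f` drawn uniformly at random among the instances (an average over the
compilation as well as over `b`); this section bounds the average over `b` against the
adversary's compilation. -/

section Adaptive

open scoped Classical

namespace DTree

variable {Q A R : Type}

/-- Prefix form of `run_eq_of_agree`: if `f'` gives the same answers as `f` on the first `m`
queries of the run on `f`, then the first `m + 1` queries of the two runs coincide — the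
`(m+1)`-st query depends only on the first `m` answers. [cite: SingkanipaEtAl2025, App. C (“the player cannot benefit from adjusting the sequence of queried bitstrings based on the learned information”)] -/
theorem queries_take_eq_of_agree {f f' : Q → A} :
    ∀ (t : DTree Q A R) (m : ℕ), (∀ q ∈ (t.queries f).take m, f' q = f q) →
      (t.queries f').take (m + 1) = (t.queries f).take (m + 1)
  | leaf _, _, _ => rfl
  | node q next, 0, _ => by simp
  | node q next, m + 1, h => by
      have hq : f' q = f q := h q (by simp)
      have ih := queries_take_eq_of_agree (next (f q)) m fun q' hq' => h q' (by simp [hq'])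
      simp only [queries_node, hq, List.take_succ_cons, ih]

end DTree

variable {R : Type}

/-- The adaptive player `t` KNOWS the mask `b` after `i` rounds of its run on the oracle `f`:
every instance satisfying condition (ii) with a mask in `S` and returning the answers received in
those rounds has mask `b` (“S ∖ S_k should contain at most one element”, read on the transcript
of an adaptive run). [cite: SingkanipaEtAl2025, App. C] -/
def KnowsOn (S : Finset (Bits n)) (t : DTree (Bits n) (Bits n) R) (f : Bits n → Bits n) (i : ℕ)
    (b : Bits n) : Prop :=
  ∀ b' ∈ S, ∀ f' : Bits n → Bits n, HasXorMask f' b' →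
    (∀ x ∈ (t.queries f).take i, f' x = f x) → b' = b

/-- Knowledge along a run is monotone in the number of rounds. [cite: SingkanipaEtAl2025, App. C (R_m ⊆ R_{m+1})] -/
theorem KnowsOn.mono {S : Finset (Bits n)} {t : DTree (Bits n) (Bits n) R} {f : Bits n → Bits n}
    {i j : ℕ} (hij : i ≤ j) {b : Bits n} (h : KnowsOn S t f i b) : KnowsOn S t f j b :=
  fun b' hb' f' hf' hagree => h b' hb' f' hf' fun x hx =>
    hagree x (List.take_subset_take_left (l := t.queries f) hij hx)

/-- **A collision reveals the mask** (“If b ∈ R_m, then b = x_j ⊕ x_l for some j, l ≤ m and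
y_j = y_l. In this case, the player knows b”): on an instance `f` with nonzero mask `b`, once two
queried points differ by `b` every instance consistent with the answers has mask `b`.
[cite: SingkanipaEtAl2025, App. C] -/
theorem knowsOn_of_bad {S : Finset (Bits n)} {t : DTree (Bits n) (Bits n) R} {f : Bits n → Bits n}
    {b : Bits n} (hb : b ≠ fun _ => false) (hf : HasXorMask f b) {i : ℕ}
    (hbad : Bad b ((t.queries f).take i)) : KnowsOn S t f i b := by
  intro b' _ f' hf' hagree
  obtain ⟨a, ha, c, hc, hac⟩ := hbad
  -- the collision `f a = f c` is visible in the transcript, so `f'` collides there too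
  have hfc : f a = f c := (hf a c).2 (Or.inr (by rw [← hac]; rfl))
  have hf'c : f' a = f' c := by rw [hagree a ha, hagree c hc, hfc]
  rcases (hf' a c).1 hf'c with h | h
  · -- `c = a` would force `b = 0`
    exact absurd ((bxor_eq_self_iff a b).1 (hac.trans h)) hb
  · -- `c = a ⊕ b'` and `c = a ⊕ b`
    have h1 : b' = bxor a c := (bxor_eq_iff a b' c).1 (by rw [h]; rfl)
    have h2 : b = bxor a c := (bxor_eq_iff a b c).1 hac
    rw [h1, h2]

/-- The number of queries the adaptive player `t` spends on the oracle `f` before knowing `b`: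
the rounds `i < |t.queries f|` at which `i` answers are not enough (the adaptive analogue of
`queriesNeeded`). [cite: SingkanipaEtAl2025, App. C display (C5) (“the probability that the next query #i+1 is needed”)] -/
def queriesNeededOn (S : Finset (Bits n)) (t : DTree (Bits n) (Bits n) R) (f : Bits n → Bits n)
    (b : Bits n) : ℕ :=
  ((range (t.queries f).length).filter fun i => ¬ KnowsOn S t f i b).card

/-- The player never spends more queries than its run has. [cite: SingkanipaEtAl2025, App. C] -/
theorem queriesNeededOn_le_length (S : Finset (Bits n)) (t : DTree (Bits n) (Bits n) R)
    (f : Bits n → Bits n) (b : Bits n) : queriesNeededOn S t f b ≤ (t.queries f).length := by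
  unfold queriesNeededOn
  exact (card_filter_le _ _).trans (by simp)

/-- The length of the collision-free prefix, for the mask `b`, of the player's query sequence
against the injective oracle: the last `m ≤ |t.queries id|` with `b ∉ R_m`.
[cite: SingkanipaEtAl2025, App. C (R_m)] -/
def goodPrefix (t : DTree (Bits n) (Bits n) R) (b : Bits n) : ℕ :=
  Nat.findGreatest (fun m => ¬ Bad b ((t.queries id).take m)) (t.queries id).length

/-- The prefix of length `goodPrefix t b` shows no `b`-collision. [cite: SingkanipaEtAl2025, App. C] -/
theorem not_bad_take_goodPrefix (t : DTree (Bits n) (Bits n) R) (b : Bits n) :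
    ¬ Bad b ((t.queries id).take (goodPrefix t b)) :=
  Nat.findGreatest_spec (P := fun m => ¬ Bad b ((t.queries id).take m)) (Nat.zero_le _)
    (by simp [Bad])

/-- Every collision-free round lies inside the good prefix. [cite: SingkanipaEtAl2025, App. C] -/
theorem le_goodPrefix (t : DTree (Bits n) (Bits n) R) {b : Bits n} {i : ℕ}
    (hi : i ≤ (t.queries id).length) (hnb : ¬ Bad b ((t.queries id).take i)) :
    i ≤ goodPrefix t b :=
  Nat.le_findGreatest (P := fun m => ¬ Bad b ((t.queries id).take m)) hi hnb

/-- **The adversary's compilation against `t` for the mask `b`**: the instance `prefRep Q b`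
answering every point of the collision-free prefix `Q` of `t`'s `id`-run by the point itself
(“f(x) = f₁(f₀(x)) where f₀ is any 2-to-1 function satisfying condition (ii) with the same b and
f₁ … is a permutation”, §II.C — here `f₁` is chosen against the player).
[cite: SingkanipaEtAl2025, §II.C and App. C] -/
def advInstance (t : DTree (Bits n) (Bits n) R) (b : Bits n) : Bits n → Bits n :=
  prefRep ((t.queries id).take (goodPrefix t b)).toFinset b

/-- No two points of the good prefix differ by `b` (finset form of `not_bad_take_goodPrefix`,
the hypothesis of `hasXorMask_prefRep`). [folklore] -/
private theorem advInstance_hQ (t : DTree (Bits n) (Bits n) R) (b : Bits n) :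
    ∀ a ∈ ((t.queries id).take (goodPrefix t b)).toFinset,
      bxor a b ∉ ((t.queries id).take (goodPrefix t b)).toFinset :=
  fun a ha hmem => not_bad_take_goodPrefix t b
    ⟨a, List.mem_toFinset.1 ha, bxor a b, List.mem_toFinset.1 hmem, rfl⟩

/-- The adversary's compilation satisfies Simon's condition (ii) with mask `b`.
[cite: SingkanipaEtAl2025, §II.A (ii)] -/
theorem hasXorMask_advInstance (t : DTree (Bits n) (Bits n) R) (b : Bits n) :
    HasXorMask (advInstance t b) b :=
  (hasXorMask_prefRep (advInstance_hQ t b)).1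

/-- … and answers every point of the good prefix by itself, as `id` does. [cite: SingkanipaEtAl2025, App. C] -/
theorem advInstance_eq_self (t : DTree (Bits n) (Bits n) R) {b x : Bits n}
    (hx : x ∈ (t.queries id).take (goodPrefix t b)) : advInstance t b x = x :=
  (hasXorMask_prefRep (advInstance_hQ t b)).2 x (List.mem_toFinset.2 hx)

/-- On the adversary's compilation the player re-asks its `id`-run queries up to and including
the first `b`-collision. [cite: SingkanipaEtAl2025, App. C (“can assume that the classical algorithm is fully described by the sequence x₁, x₂, …, x_k”)] -/
theorem queries_advInstance_take (t : DTree (Bits n) (Bits n) R) (b : Bits n) :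
    (t.queries (advInstance t b)).take (goodPrefix t b + 1) =
      (t.queries id).take (goodPrefix t b + 1) :=
  DTree.queries_take_eq_of_agree t _ fun _ hx => advInstance_eq_self t hx

/-- **Adaptivity does not help (adversary form).**  At every round at which the non-adaptive
player asking `xs = t.queries id` does not yet know `b` (no `b`-collision so far and another
collision-free candidate in `S`), the adaptive player `t` run on `advInstance t b` has asked
exactly the same points, received them back, and cannot know `b` either: the other candidate's
`prefRep` instance returns the same answers.  Hence `Q_C(b)` for `t` on the adversary's
compilation is at least the count `queriesNeeded S xs b`. [cite: SingkanipaEtAl2025, App. C] -/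
theorem queriesNeeded_le_queriesNeededOn (S : Finset (Bits n)) (t : DTree (Bits n) (Bits n) R)
    (b : Bits n) : queriesNeeded S (t.queries id) b ≤ queriesNeededOn S t (advInstance t b) b := by
  unfold queriesNeeded queriesNeededOn
  refine card_le_card fun i hi => ?_
  rw [mem_filter, mem_range] at hi ⊢
  obtain ⟨hi, hnot⟩ := hi
  have hnb : ¬ Bad b ((t.queries id).take i) := fun h => hnot (Or.inl h)
  obtain ⟨b', hb'S, hnb', hne⟩ :
      ∃ b' ∈ S, ¬ Bad b' ((t.queries id).take i) ∧ b' ≠ b := by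
    by_contra hcon
    exact hnot (Or.inr fun b' hb' hnbad =>
      Classical.byContradiction fun h => hcon ⟨b', hb', hnbad, h⟩)
  have him : i ≤ goodPrefix t b := le_goodPrefix t hi.le hnb
  have htake := queries_advInstance_take t b
  -- the first `i` queries on the compilation are the first `i` queries of the `id`-run
  have htake_i : (t.queries (advInstance t b)).take i = (t.queries id).take i := by
    have := congrArg (List.take i) htake
    rwa [List.take_take, List.take_take, min_eq_left (by omega : i ≤ goodPrefix t b + 1)]
      at this
  -- the other candidate's instance: no `b'`-collision on the first `i` points
  have hQ' : ∀ a ∈ ((t.queries id).take i).toFinset,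
      bxor a b' ∉ ((t.queries id).take i).toFinset := fun a ha hmem =>
    hnb' ⟨a, List.mem_toFinset.1 ha, bxor a b', List.mem_toFinset.1 hmem, rfl⟩
  obtain ⟨hmask', hagree'⟩ := hasXorMask_prefRep hQ'
  refine ⟨?_, fun hK => hne (hK b' hb'S _ hmask' fun x hx => ?_)⟩
  · -- round `i` exists on the compilation
    have hlen := congrArg List.length htake
    rw [List.length_take, List.length_take] at hlen
    have hlt : i < min (goodPrefix t b + 1) (t.queries id).length := lt_min (by omega) hi
    rw [← hlen] at hlt
    exact lt_of_lt_of_le hlt (min_le_right _ _)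
  · -- both instances answer the first `i` queried points by themselves
    rw [htake_i] at hx
    rw [hagree' x (List.mem_toFinset.2 hx),
      advInstance_eq_self t (List.take_subset_take_left (l := t.queries id) him hx)]

/-- **Eq. (4) for every adaptive classical player (adversary form).**  For a decision tree `t`
asking at least `k` queries on the injective oracle and a set `S` of nonzero masks with
`C(k−1, 2) + 2 ≤ |S|` (every `k ≤ k_min(|S|)`), the average over the uniform prior on `S` of
the number of queries `t` spends before knowing `b`, each mask `b` compiled by the adversary as
`advInstance t b`, is at least `k − k(k−1)(k−2)/(6|S|)`.
[cite: SingkanipaEtAl2025, §III.A eq. (4) and App. C (C5)] -/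
theorem sub_le_avg_queriesNeededOn (S : Finset (Bits n)) (h0 : (fun _ => false : Bits n) ∉ S)
    (t : DTree (Bits n) (Bits n) R) {k : ℕ} (hk : k ≤ (t.queries id).length)
    (hS : (k - 1).choose 2 + 2 ≤ S.card) :
    (k : ℚ) - (k : ℚ) * (k - 1) * (k - 2) / (6 * S.card) ≤
      (∑ b ∈ S, (queriesNeededOn S t (advInstance t b) b : ℚ)) / S.card := by
  refine (sub_le_avg_queriesNeeded S h0 (t.queries id) hk hS).trans
    (div_le_div_of_nonneg_right (sum_le_sum fun b _ => ?_) (Nat.cast_nonneg _))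
  exact_mod_cast queriesNeeded_le_queriesNeededOn S t b

/-- **Eq. (5) for every adaptive classical player (adversary form)**: with `S` the admissible
masks of wwSimon-n (`|S| = N_w = Σ_{j=1}^{w} C(n,j)`), every decision tree asking at least
`k` queries on the injective oracle, `C(k−1,2) + 2 ≤ N_w`, spends on average (uniform prior on
the mask, adversary's compilation) at least `NTS^lb_C = k − k(k−1)(k−2)/(6N_w)` queries before
knowing the mask. [cite: SingkanipaEtAl2025, §III.A eq. (5)] -/
theorem ntsLowerBound_le_avg_queriesNeededOn {w : ℕ} (t : DTree (Bits n) (Bits n) R) {k : ℕ}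
    (hk : k ≤ (t.queries id).length) (hS : (k - 1).choose 2 + 2 ≤ ∑ j ∈ Icc 1 w, n.choose j) :
    (k : ℚ) - (k : ℚ) * (k - 1) * (k - 2) / (6 * (∑ j ∈ Icc 1 w, n.choose j : ℕ)) ≤
      (∑ b ∈ admissible n w,
          (queriesNeededOn (admissible n w) t (advInstance t b) b : ℚ)) /
        (∑ j ∈ Icc 1 w, n.choose j : ℕ) := by
  rw [← card_admissible] at hS ⊢
  exact sub_le_avg_queriesNeededOn _ (zero_notMem_admissible n w) t hk hS

end Adaptive

/-! ## App. C as printed (v4): `f` uniformly random among the instances, adaptive player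

The paper's own reading of ⟨Q_C⟩: “Under the assumption that f is a uniformly random function
satisfying conditions (i)–(iii) … if b ∉ R_m, then the only information learned after m queries
is that b is not in R_m. Thus, the player cannot benefit from adjusting the sequence of queried
bitstrings” (App. C).  In the tree's model of a random instance with mask `s` — `twoToOne s g =
g ∘ rep s` for a uniformly random permutation `g` (`SimonQueryBound.lean`, the model of
`simon_lower_holds`) — this section proves eqs. (4)–(5) for every ADAPTIVE deterministic player,
averaged over the uniform prior on `S` AND over the compilation `g`: the key input is
`SimonQueryBound.bad_eq` (the number of compilations on which the first `i` queries of the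
player collide under `s` is the same in the two-to-one world as in the injective world — de
Wolf's “each sequence of T distinct outcomes is equally likely”), applied to the depth-`i`
truncation of the tree, together with `card_filter_bad_take_le` (`|S_i| ≤ C(i,2)`) in the
injective world and a consistent competing instance (`not_knowsOn_twoToOne`: a permutation
extending the received answers composed with `prefRep`). -/

section RandomCompilation

open scoped Classical

namespace DTree

variable {Q A R : Type}

/-- The decision tree cut off after `i` queries (results forgotten). [cite: deWolf2019, §3.3.2 (“deterministic T-query algorithm”)] -/
def truncate : ℕ → DTree Q A R → DTree Q A Unit
  | 0, _ => leaf ()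
  | _ + 1, leaf _ => leaf ()
  | i + 1, node q next => node q fun a => truncate i (next a)

/-- The truncated tree asks exactly the first `i` queries. [cite: deWolf2019, §3.3.2] -/
theorem queries_truncate (f : Q → A) :
    ∀ (i : ℕ) (t : DTree Q A R), (truncate i t).queries f = (t.queries f).take i
  | 0, leaf _ => rfl
  | 0, node _ _ => rfl
  | _ + 1, leaf _ => rfl
  | i + 1, node q next => by
      simp only [truncate, queries_node, List.take_succ_cons, queries_truncate f i (next (f q))]

end DTree

/-- An injective partial map on finitely many points extends to a permutation
(`Finset.exists_equiv_extend_of_card_eq`). [folklore] -/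
private theorem exists_perm_extend (T : Finset (Bits n)) (φ : Bits n → Bits n)
    (hφ : Set.InjOn φ ↑T) : ∃ g : Equiv.Perm (Bits n), ∀ x ∈ T, g x = φ x := by
  obtain ⟨g, hg⟩ := Finset.exists_equiv_extend_of_card_eq (t := (univ : Finset (Bits n)))
    (Finset.card_univ (α := Bits n)).symm (s := T) (f := φ) (Finset.subset_univ _) hφ
  exact ⟨g.trans (Equiv.subtypeUnivEquiv Finset.mem_univ), fun x hx => by
    rw [Equiv.trans_apply]
    exact hg x hx⟩

/-- Relabelling the values of an instance by a permutation keeps condition (ii). [folklore] -/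
private theorem hasXorMask_perm_comp {φ : Bits n → Bits n} {s : Bits n} (hφ : HasXorMask φ s)
    (g : Equiv.Perm (Bits n)) : HasXorMask (g ∘ φ) s := fun x y => by
  simp only [Function.comp_apply, g.injective.eq_iff]
  exact hφ x y

variable {R : Type}

/-- **On a random compilation the player does not know `b` before a collision, as long as another
candidate is collision-free too.**  On the instance `twoToOne s g`, if the first `i` queried
points show no `s`-collision and no `b'`-collision for some other `b' ∈ S`, then an instance with
mask `b'` returns the very same answers: a permutation extending the received (pairwise distinct)
answers, composed with `prefRep` for `b'` (“if b ∉ S_k, then this is the only information about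
b available to the player, i.e., their posterior distribution of all possible values of b is
uniform in S ∖ S_k”). [cite: SingkanipaEtAl2025, App. C] -/
theorem not_knowsOn_twoToOne {S : Finset (Bits n)} (t : DTree (Bits n) (Bits n) R)
    (g : Equiv.Perm (Bits n)) {s b' : Bits n} (hb' : b' ∈ S) (hne : b' ≠ s) {i : ℕ}
    (hs : ¬ Bad s ((t.queries (twoToOne s g)).take i))
    (hnb' : ¬ Bad b' ((t.queries (twoToOne s g)).take i)) :
    ¬ KnowsOn S t (twoToOne s g) i s := by
  intro hK
  set L := (t.queries (twoToOne s g)).take i with hL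
  have hQ' : ∀ a ∈ L.toFinset, bxor a b' ∉ L.toFinset := fun a ha hmem =>
    hnb' ⟨a, List.mem_toFinset.1 ha, bxor a b', List.mem_toFinset.1 hmem, rfl⟩
  obtain ⟨hmask, hagree⟩ := hasXorMask_prefRep hQ'
  -- the received answers are pairwise distinct on the queried points (no `s`-collision)
  have hinj : Set.InjOn (fun x => g (rep s x)) ↑L.toFinset := by
    intro x hx x' hx' h
    have h' : rep s x = rep s x' := g.injective h
    rcases eq_or_eq_bxor_of_rep_eq h' with h'' | h''
    · exact h''.symm
    · exact absurd ⟨x, List.mem_toFinset.1 (Finset.mem_coe.1 hx), x',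
        List.mem_toFinset.1 (Finset.mem_coe.1 hx'), h''.symm⟩ hs
  obtain ⟨g', hg'⟩ := exists_perm_extend L.toFinset _ hinj
  refine hne (hK b' hb' (g' ∘ prefRep L.toFinset b') (hasXorMask_perm_comp hmask g')
    fun x hx => ?_)
  have hxQ : x ∈ L.toFinset := List.mem_toFinset.2 hx
  show g' (prefRep L.toFinset b' x) = g (rep s x)
  rw [hagree x hxQ, hg' x hxQ]

/-- **The two worlds have the same collision statistics** (`SimonQueryBound.bad_eq` for the
depth-`i` truncation): the number of compilations `g` on which the first `i` queries of `t`
against `twoToOne s g` show an `s`-collision equals the number of permutations `g` on which the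
first `i` queries against the INJECTIVE oracle `g` do (“each sequence of T distinct outcomes is
equally likely — just as in the s = 0ⁿ case”). [cite: deWolf2019, §3.3.2] -/
theorem card_filter_not_bad_twoToOne_eq (s : Bits n) (t : DTree (Bits n) (Bits n) R) (i : ℕ) :
    ((univ : Finset (Equiv.Perm (Bits n))).filter
        fun g => ¬ Bad s ((t.queries (twoToOne s g)).take i)).card =
      ((univ : Finset (Equiv.Perm (Bits n))).filter
        fun g : Equiv.Perm (Bits n) => ¬ Bad s ((t.queries g).take i)).card := by
  have hb := bad_eq (wCompat_rep s) (wCompat_id s) (DTree.truncate i t)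
  simp only [bad, DTree.queries_truncate, Function.comp_id] at hb
  have h1 := card_filter_add_card_filter_not (s := (univ : Finset (Equiv.Perm (Bits n))))
    (fun g => Bad s ((t.queries (twoToOne s g)).take i))
  have h2 := card_filter_add_card_filter_not (s := (univ : Finset (Equiv.Perm (Bits n))))
    (fun g : Equiv.Perm (Bits n) => Bad s ((t.queries g).take i))
  have h3 : ((univ : Finset (Equiv.Perm (Bits n))).filter
      fun g => Bad s ((t.queries (twoToOne s g)).take i)).card =
      ((univ : Finset (Equiv.Perm (Bits n))).filter
        fun g : Equiv.Perm (Bits n) => Bad s ((t.queries g).take i)).card := hb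
  omega

/-- In the injective world, summed over the prior: `Σ_{s∈S} #{g : s ∈ R_i} ≤ #g · C(i,2)`
(`|S_i| ≤ i(i−1)/2` for every transcript). [cite: SingkanipaEtAl2025, App. C (“Since there are at most i(i−1)/2 elements in S_i”)] -/
theorem sum_card_filter_bad_le (S : Finset (Bits n)) (h0 : (fun _ => false : Bits n) ∉ S)
    (t : DTree (Bits n) (Bits n) R) (i : ℕ) :
    ∑ s ∈ S, ((univ : Finset (Equiv.Perm (Bits n))).filter
        fun g : Equiv.Perm (Bits n) => Bad s ((t.queries g).take i)).card ≤
      Fintype.card (Equiv.Perm (Bits n)) * i.choose 2 := by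
  calc ∑ s ∈ S, ((univ : Finset (Equiv.Perm (Bits n))).filter
          fun g : Equiv.Perm (Bits n) => Bad s ((t.queries g).take i)).card
      = ∑ s ∈ S, ∑ g : Equiv.Perm (Bits n),
          (if Bad s ((t.queries g).take i) then 1 else 0) := by simp_rw [card_filter]
    _ = ∑ g : Equiv.Perm (Bits n), ∑ s ∈ S,
          (if Bad s ((t.queries g).take i) then 1 else 0) := sum_comm
    _ = ∑ g : Equiv.Perm (Bits n), (S.filter fun s => Bad s ((t.queries g).take i)).card := by
          simp_rw [card_filter]
    _ ≤ ∑ _g : Equiv.Perm (Bits n), i.choose 2 :=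
          sum_le_sum fun g _ => card_filter_bad_take_le S h0 _ i
    _ = Fintype.card (Equiv.Perm (Bits n)) * i.choose 2 := by
          rw [sum_const, card_univ, smul_eq_mul]

/-- **Display (C5) with `f` uniformly random and an adaptive player (count form).**  For a
decision tree `t` asking at least `k` queries on every oracle and `C(k−1,2) + 2 ≤ |S|`
(`0ⁿ ∉ S`): `#g · Σ_{i<k} (|S| − C(i,2)) ≤ Σ_{s∈S} Σ_g Q_C(t; twoToOne s g)` — summing, over
the rounds `i < k`, the number of pairs (mask, compilation) on which query `i+1` is still needed.
[cite: SingkanipaEtAl2025, App. C display (C5)] -/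
theorem card_perm_mul_sum_le_sum_queriesNeededOn (S : Finset (Bits n))
    (h0 : (fun _ => false : Bits n) ∉ S) (t : DTree (Bits n) (Bits n) R) {k : ℕ}
    (hk : ∀ f : Bits n → Bits n, k ≤ (t.queries f).length) (hS : (k - 1).choose 2 + 2 ≤ S.card) :
    (Fintype.card (Equiv.Perm (Bits n)) : ℚ) * ∑ i ∈ range k, ((S.card : ℚ) - i.choose 2) ≤
      ∑ s ∈ S, ∑ g : Equiv.Perm (Bits n), (queriesNeededOn S t (twoToOne s g) s : ℚ) := by
  set P := Fintype.card (Equiv.Perm (Bits n)) with hP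
  -- (1) pointwise: every collision-free round `i < k` is a round at which `s` is not known
  have h4 : ∀ s ∈ S, ∀ g : Equiv.Perm (Bits n),
      ((range k).filter fun i => ¬ Bad s ((t.queries (twoToOne s g)).take i)).card ≤
        queriesNeededOn S t (twoToOne s g) s := by
    intro s hs g
    unfold queriesNeededOn
    refine card_le_card fun i hi => ?_
    rw [mem_filter, mem_range] at hi ⊢
    obtain ⟨hik, hnb⟩ := hi
    refine ⟨lt_of_lt_of_le hik (hk _), ?_⟩
    have hci : i.choose 2 + 2 ≤ S.card :=
      (Nat.add_le_add_right (Nat.choose_le_choose 2 (show i ≤ k - 1 by omega)) 2).trans hS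
    have hB := card_filter_bad_take_le S h0 (t.queries (twoToOne s g)) i
    have hsplit := card_filter_add_card_filter_not (s := S)
      (fun b => Bad b ((t.queries (twoToOne s g)).take i))
    have h2 : 1 < (S.filter fun b => ¬ Bad b ((t.queries (twoToOne s g)).take i)).card := by
      omega
    obtain ⟨a, ha, c, hc, hac⟩ := one_lt_card.1 h2
    rw [mem_filter] at ha hc
    by_cases has : a = s
    · exact not_knowsOn_twoToOne t g hc.1 (fun h => hac (has.trans h.symm)) hnb hc.2
    · exact not_knowsOn_twoToOne t g ha.1 has hnb ha.2
  -- (2) per round: `P · (|S| − C(i,2)) ≤ Σ_{s∈S} #{g : no s-collision in the first i queries}`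
  have hround : ∀ i < k, (P : ℚ) * ((S.card : ℚ) - i.choose 2) ≤
      ((∑ s ∈ S, ((univ : Finset (Equiv.Perm (Bits n))).filter
        fun g => ¬ Bad s ((t.queries (twoToOne s g)).take i)).card : ℕ) : ℚ) := by
    intro i _
    have hsplit : ∀ s, ((univ : Finset (Equiv.Perm (Bits n))).filter
          fun g : Equiv.Perm (Bits n) => Bad s ((t.queries g).take i)).card +
        ((univ : Finset (Equiv.Perm (Bits n))).filter
          fun g : Equiv.Perm (Bits n) => ¬ Bad s ((t.queries g).take i)).card = P := by
      intro s
      rw [card_filter_add_card_filter_not, card_univ]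
    have hsum : ∑ s ∈ S, ((univ : Finset (Equiv.Perm (Bits n))).filter
          fun g => ¬ Bad s ((t.queries (twoToOne s g)).take i)).card +
        ∑ s ∈ S, ((univ : Finset (Equiv.Perm (Bits n))).filter
          fun g : Equiv.Perm (Bits n) => Bad s ((t.queries g).take i)).card = S.card * P := by
      rw [← sum_add_distrib]
      rw [show S.card * P = ∑ _s ∈ S, P by rw [sum_const, smul_eq_mul]]
      refine sum_congr rfl fun s _ => ?_
      rw [card_filter_not_bad_twoToOne_eq, add_comm]
      exact hsplit s
    have hle := sum_card_filter_bad_le S h0 t i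
    have hsumQ := congrArg (fun m : ℕ => (m : ℚ)) hsum
    push_cast at hsumQ ⊢
    have hleQ : ((∑ s ∈ S, ((univ : Finset (Equiv.Perm (Bits n))).filter
        fun g : Equiv.Perm (Bits n) => Bad s ((t.queries g).take i)).card : ℕ) : ℚ) ≤
        (P : ℚ) * i.choose 2 := by exact_mod_cast hle
    push_cast at hleQ
    linarith
  -- (3) sum over the rounds and exchange the sums
  have hswap : ∑ i ∈ range k, ∑ s ∈ S, ((univ : Finset (Equiv.Perm (Bits n))).filter
        fun g => ¬ Bad s ((t.queries (twoToOne s g)).take i)).card =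
      ∑ s ∈ S, ∑ g : Equiv.Perm (Bits n),
        ((range k).filter fun i => ¬ Bad s ((t.queries (twoToOne s g)).take i)).card := by
    simp_rw [card_filter]
    rw [sum_comm]
    exact sum_congr rfl fun s _ => sum_comm
  calc (P : ℚ) * ∑ i ∈ range k, ((S.card : ℚ) - i.choose 2)
      = ∑ i ∈ range k, (P : ℚ) * ((S.card : ℚ) - i.choose 2) := mul_sum _ _ _
    _ ≤ ∑ i ∈ range k, ((∑ s ∈ S, ((univ : Finset (Equiv.Perm (Bits n))).filter
          fun g => ¬ Bad s ((t.queries (twoToOne s g)).take i)).card : ℕ) : ℚ) :=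
        sum_le_sum fun i hi => hround i (mem_range.1 hi)
    _ = ((∑ s ∈ S, ∑ g : Equiv.Perm (Bits n),
          ((range k).filter fun i => ¬ Bad s ((t.queries (twoToOne s g)).take i)).card : ℕ) :
            ℚ) := by rw [← hswap]; push_cast; rfl
    _ ≤ ∑ s ∈ S, ∑ g : Equiv.Perm (Bits n), (queriesNeededOn S t (twoToOne s g) s : ℚ) := by
        push_cast
        exact sum_le_sum fun s hs => sum_le_sum fun g _ => by exact_mod_cast h4 s hs g

/-- From the count form to the printed form of eq. (4). [folklore] -/
private theorem avg_bound_of_count {N P k : ℕ} (hN : 0 < N) (hP : 0 < P) {T : ℚ}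
    (hle : (P : ℚ) * ∑ i ∈ range k, ((N : ℚ) - i.choose 2) ≤ T) :
    (k : ℚ) - (k : ℚ) * (k - 1) * (k - 2) / (6 * N) ≤ T / (N * P) := by
  have hhockey : ∀ m : ℕ, ∑ i ∈ range m, i.choose 2 = m.choose 3 := by
    intro m
    induction m with
    | zero => simp
    | succ m ih => rw [sum_range_succ, ih, Nat.choose_succ_succ' m 2, add_comm]
  have hsum : ∑ i ∈ range k, ((i.choose 2 : ℕ) : ℚ) = k.choose 3 := by
    exact_mod_cast congrArg (fun m : ℕ => (m : ℚ)) (hhockey k)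
  have h6 : ((k.choose 3 : ℕ) : ℚ) = (k : ℚ) * (k - 1) * (k - 2) / 6 := by
    have h := congrArg (fun m : ℕ => (m : ℚ)) (six_mul_choose_three k)
    push_cast at h
    rcases Nat.lt_or_ge k 2 with hk2 | hk2
    · interval_cases k <;> simp
    · rw [Nat.cast_sub (by omega : 1 ≤ k), Nat.cast_sub hk2] at h
      push_cast at h
      linarith
  have hsplit : ∑ i ∈ range k, ((N : ℚ) - i.choose 2) = (k : ℚ) * N - k.choose 3 := by
    rw [sum_sub_distrib, sum_const, card_range, hsum, nsmul_eq_mul]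
  rw [hsplit, h6] at hle
  have hN' : (0 : ℚ) < N := by exact_mod_cast hN
  have hP' : (0 : ℚ) < P := by exact_mod_cast hP
  rw [le_div_iff₀ (mul_pos hN' hP')]
  have : ((k : ℚ) - (k : ℚ) * (k - 1) * (k - 2) / (6 * N)) * (N * P) =
      (P : ℚ) * ((k : ℚ) * N - (k : ℚ) * (k - 1) * (k - 2) / 6) := by
    field_simp
  rw [this]
  exact hle

/-- **Eq. (4) as printed: `f` uniformly random among the instances, adaptive player.**  For every
decision tree `t` asking at least `k` queries on every oracle and every set `S` of nonzero masks
with `C(k−1, 2) + 2 ≤ |S|` (every `k ≤ k_min(|S|)`), the expected number of queries before the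
player knows `b` — `b` uniform on `S`, the instance `twoToOne b g` with `g` a uniformly random
permutation — is at least `k − k(k−1)(k−2)/(6|S|)`.
[cite: SingkanipaEtAl2025, §III.A eq. (4) and App. C (“f is a uniformly random function satisfying conditions (i)–(iii)”, (C5))] -/
theorem sub_le_avg_queriesNeededOn_twoToOne (S : Finset (Bits n))
    (h0 : (fun _ => false : Bits n) ∉ S) (t : DTree (Bits n) (Bits n) R) {k : ℕ}
    (hk : ∀ f : Bits n → Bits n, k ≤ (t.queries f).length) (hS : (k - 1).choose 2 + 2 ≤ S.card) :
    (k : ℚ) - (k : ℚ) * (k - 1) * (k - 2) / (6 * S.card) ≤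
      (∑ s ∈ S, ∑ g : Equiv.Perm (Bits n), (queriesNeededOn S t (twoToOne s g) s : ℚ)) /
        (S.card * Fintype.card (Equiv.Perm (Bits n))) :=
  avg_bound_of_count (by omega) Fintype.card_pos
    (card_perm_mul_sum_le_sum_queriesNeededOn S h0 t hk hS)

/-- **Eq. (5) as printed, for wwSimon-n**: with `S` the admissible masks
(`|S| = N_w = Σ_{j=1}^{w} C(n,j)`), every adaptive classical player asking at least `k` queries,
`C(k−1,2) + 2 ≤ N_w`, needs on average — mask uniform, compilation uniformly random — at least
`NTS^lb_C = k − k(k−1)(k−2)/(6N_w)` queries before knowing the mask. [cite: SingkanipaEtAl2025, §III.A eq. (5)] -/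
theorem ntsLowerBound_le_avg_queriesNeededOn_twoToOne {w : ℕ} (t : DTree (Bits n) (Bits n) R)
    {k : ℕ} (hk : ∀ f : Bits n → Bits n, k ≤ (t.queries f).length)
    (hS : (k - 1).choose 2 + 2 ≤ ∑ j ∈ Icc 1 w, n.choose j) :
    (k : ℚ) - (k : ℚ) * (k - 1) * (k - 2) / (6 * (∑ j ∈ Icc 1 w, n.choose j : ℕ)) ≤
      (∑ s ∈ admissible n w, ∑ g : Equiv.Perm (Bits n),
          (queriesNeededOn (admissible n w) t (twoToOne s g) s : ℚ)) /
        ((∑ j ∈ Icc 1 w, n.choose j : ℕ) * Fintype.card (Equiv.Perm (Bits n))) := by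
  rw [← card_admissible] at hS ⊢
  exact sub_le_avg_queriesNeededOn_twoToOne _ (zero_notMem_admissible n w) t hk hS

end RandomCompilation

end SimonLB

end Literature.Computability.QuantumComplexity
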